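import Literature.AlgebraicGeometry.Motives.CartierDivisorSameDivisorIdealSheaf
import Literature.AlgebraicGeometry.Motives.JacobianThetaDivisorUniq
import HarnessLib

/-!
# A principal-polarisation theta divisor is the reduced `W̃_{g−1}`: the closed subscheme `Z(Θ)` is integral

Layer `Literature/AlgebraicGeometry/Motives` (namespaces `….Motives.AbelianVariety`, `….Motives.Jacobian`).  KERNEL ONLY (theorems; no
definition, no named fact, no instance, no `sorry`).

Lange, *Abelian Varieties over the Complex Numbers* (2023), §4.2.1 Lemma 4.2.1 (ii) and Cor. 4.2.4: `W̃_{g−1}` is irreducible of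
codimension one and every theta divisor of the canonical (principal) polarisation is a translate `t_x^* W̃_{g−1}` — with MULTIPLICITY ONE:
an effective divisor `Θ` on the (regular) Jacobian `J` with irreducible support is `a • [supp Θ]`, `a ≥ 1` ([Hartshorne1977] II 6.11, ★
`CartierDivisor.IsEffective.exists_sameDivisor_smul_of_support_eq_closure`), and a principal polarisation divisor is not a proper multiple
(★ `AbelianVariety.eq_one_of_isPrincipalPolarizationDivisor_smul`: `A[m] ≤ K(m • D) = 0`).  Hence (★
`CartierDivisor.IsEffective.idealSheaf_eq_primeDivisorIdeal_of_forall_eq_one`) the ideal sheaf `𝒪_J(−Θ)` IS the ideal `𝓘_{supp Θ}` of the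
reduced closed subscheme on the support, and the closed subscheme `Z(Θ) = V(𝒪_J(−Θ))` is INTEGRAL with underlying set `supp Θ = t_x(W̃_{g−1}(P))`.

* §1 (any complex abelian variety `A`, `dim A ≥ 1`) `AbelianVariety.IsPrincipalPolarizationDivisor.eq_one_of_sameDivisor_smul` (the
  multiplicity-one socket `hone` of ★ `…idealSheaf_eq_primeDivisorIdeal_of_forall_eq_one`), `….idealSheaf_eq_primeDivisorIdeal`,
  `….isIntegral_subscheme_idealSheaf`, `….isReduced_subscheme_idealSheaf` (effective principal polarisation divisor with irreducible support).
* §2 (Jacobian of a smooth projective complex curve, `dim J ≥ 1`, `Θ` Riemann + principal) **`Jacobian.IsRiemannThetaDivisor.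
  idealSheaf_eq_primeDivisorIdeal`**, **`….isIntegral_subscheme`**, `….isReduced_subscheme`, `….range_subschemeι` (`= (Θ.nonvanishing 1)ᶜ`),
  and the normalisation **`Jacobian.IsRiemannThetaDivisor.exists_translate_support_eq_brillNoetherLocus`**: some translate `t_y^*Θ` is again
  Riemann + principal with support EXACTLY `W̃_{g−1}(P)` — so `W̃ := Z(t_y^*Θ)` is the integral closed subscheme of `J` with underlying set
  `W̃_{g−1}(P)` and `𝒪_J(−t_y^*Θ) = vanishingIdeal W̃_{g−1}(P)` BY NAME (`idealSheaf_eq_vanishingIdeal_brillNoetherLocus`,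
  `exists_translate_isIntegral_subscheme_range_eq_brillNoetherLocus`; cf. ★ `Jacobian.exists_isClosedImmersion_range_eq_brillNoetherLocus`).

Use (cell `hodgecm-mathlib`, D-0151; crux HLiu418 = stmt-HodgeConjecture-24832, road G4 → VI-8 (F-P2), Step I of Lange Lemma 4.4.4 on road
(E) (architect A-p02 (g15) 2026-08-30: the hypotheses «`W̃.ι` closed immersion, `IsIntegral W̃`, `range W̃.ι = W̃_{g−1}(P)`» of the leaves
(P0)/(P2)/(P3) are DISCHARGED here with `W̃ := Z(t_y^*Θ)`, `W̃.ι := subschemeι`).  COUNT-NEUTRAL.  HC_CM is proved only modulo the 7 printed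
citations until rung 0 closes; this file moves no book by itself.

## References
* [Lange2023AbelianVarietiesComplex] H. Lange, *Abelian Varieties over the Complex Numbers* (2023), §4.2.1 Lemma 4.2.1 (ii) and Cor. 4.2.4.
* [Milne1986JacobianVarieties] J. S. Milne, *Jacobian Varieties*, in Cornell–Silverman (1986), §6 (`Θ = W^{g−1}`, before Thm. 6.6).
* [Hartshorne1977] R. Hartshorne, *Algebraic Geometry* (1977), II.6 Prop. 6.11 and Remark 6.11.2 (pp. 141–142).
* [MumfordAV1970] D. Mumford, *Abelian Varieties* (1970), §6 Application 3 (Proposition p. 64).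
* [GortzWedhorn2023] U. Görtz, T. Wedhorn, *Algebraic Geometry II* (2023), Def./Rem. 27.1 (pp. 604–605) (translations).
-/

set_option autoImplicit false

noncomputable section

universe u

open CategoryTheory AlgebraicGeometry

namespace Literature.AlgebraicGeometry.Motives

open Literature.AlgebraicGeometry.Resolution

/-! ## §1 Principal polarisation divisors have multiplicity one -/

namespace AbelianVariety

variable (A : AbelianVariety ℂ)

variable {A} in
/-- **A principal polarisation divisor is not a proper multiple, as a divisor**: if `Θ` defines a principal polarisation of the complex
abelian variety `A` (`dim A ≥ 1`) and `Θ ≈ m • E` (same divisor) with `m ≥ 1`, then `m = 1` (★ `IsPrincipalPolarizationDivisor.congr_sameDivisor`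
+ ★ `eq_one_of_isPrincipalPolarizationDivisor_smul`).  This is the socket `hone` of ★
`CartierDivisor.IsEffective.idealSheaf_eq_primeDivisorIdeal_of_forall_eq_one`. [cite: Lange2023AbelianVarietiesComplex, §4.2.1 Cor. 4.2.4]
[cite: Lange2023AbelianVarietiesComplex, §2.1.1 (p. 68) and §1.4.2 Prop. 1.4.7] [cite: MumfordAV1970, §6 Application 3 (Proposition p. 64)] -/
theorem IsPrincipalPolarizationDivisor.eq_one_of_sameDivisor_smul (hA : 1 ≤ A.dim) {Θ : CartierDivisor A.X.left}
    (h : A.IsPrincipalPolarizationDivisor Θ) (E : CartierDivisor A.X.left) (m : ℕ) (hm : 0 < m) (hs : Θ.SameDivisor (m • E)) : m = 1 :=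
  A.eq_one_of_isPrincipalPolarizationDivisor_smul hA E hm.ne' (h.congr_sameDivisor hs)

variable {A} in
/-- **`𝒪_A(−Θ) = 𝓘_{supp Θ}` for an effective principal polarisation divisor with irreducible support `A ∖ A_1 = cl{η}`** (`A` complex,
`dim A ≥ 1`; `A` is regular ★ `isRegularLocalRing_stalk`, integral, Noetherian ★ `isNoetherian_left`). [cite: Hartshorne1977, II.6 Prop. 6.11 and Remark 6.11.2 (pp. 141–142)]
[cite: Lange2023AbelianVarietiesComplex, §4.2.1 Cor. 4.2.4] -/
theorem IsPrincipalPolarizationDivisor.idealSheaf_eq_primeDivisorIdeal (hA : 1 ≤ A.dim) {Θ : CartierDivisor A.X.left}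
    (hΘ : Θ.IsEffective) (h : A.IsPrincipalPolarizationDivisor Θ) {η : A.X.left} (hη : (Θ.nonvanishing 1)ᶜ = closure {η}) :
    hΘ.idealSheaf = primeDivisorIdeal η := by
  haveI := A.isNoetherian_left
  exact hΘ.idealSheaf_eq_primeDivisorIdeal_of_forall_eq_one (fun x => A.isRegularLocalRing_stalk x) hη
    fun E m hm hs => h.eq_one_of_sameDivisor_smul hA E m hm hs

variable {A} in
/-- **`Z(Θ)` is integral** for an effective principal polarisation divisor `Θ` with irreducible support on a complex abelian variety of
positive dimension. [cite: Hartshorne1977, II.6 Prop. 6.11 and Remark 6.11.2 (pp. 141–142)] [cite: Lange2023AbelianVarietiesComplex, §4.2.1 Cor. 4.2.4] -/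
theorem IsPrincipalPolarizationDivisor.isIntegral_subscheme_idealSheaf (hA : 1 ≤ A.dim) {Θ : CartierDivisor A.X.left}
    (hΘ : Θ.IsEffective) (h : A.IsPrincipalPolarizationDivisor Θ) (hirr : IsIrreducible (Θ.nonvanishing 1)ᶜ) :
    IsIntegral hΘ.idealSheaf.subscheme := by
  haveI := A.isNoetherian_left
  have hη : (Θ.nonvanishing 1)ᶜ = closure {hirr.genericPoint} :=
    (hirr.closure_genericPoint (Θ.isOpen_nonvanishing 1).isClosed_compl).symm
  exact hΘ.isIntegral_subscheme_idealSheaf_of_forall_eq_one (fun x => A.isRegularLocalRing_stalk x) hη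
    fun E m hm hs => h.eq_one_of_sameDivisor_smul hA E m hm hs

variable {A} in
/-- **`Z(Θ)` is reduced** for an effective principal polarisation divisor `Θ` with irreducible support on a complex abelian variety of
positive dimension. [cite: Hartshorne1977, II.6 Prop. 6.11 and Remark 6.11.2 (pp. 141–142)] [cite: Lange2023AbelianVarietiesComplex, §4.2.1 Cor. 4.2.4] -/
theorem IsPrincipalPolarizationDivisor.isReduced_subscheme_idealSheaf (hA : 1 ≤ A.dim) {Θ : CartierDivisor A.X.left}
    (hΘ : Θ.IsEffective) (h : A.IsPrincipalPolarizationDivisor Θ) (hirr : IsIrreducible (Θ.nonvanishing 1)ᶜ) :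
    IsReduced hΘ.idealSheaf.subscheme :=
  haveI := h.isIntegral_subscheme_idealSheaf hA hΘ hirr
  inferInstance

/-- `t_{x⁻¹}(t_x(S)) = S` on the underlying space of `A` (★ `translation_comp`, ★ `translation_one`). [cite: GortzWedhorn2023, Def./Rem. 27.1 (pp. 604–605)] -/
private theorem image_translation_inv_image_translation {K : Type u} [Field K] (B : AbelianVariety K) (x : B.Points K)
    (S : Set B.X.left) : (B.translation x⁻¹).left.base '' ((B.translation x).left.base '' S) = S := by
  have h : ∀ z, (B.translation x⁻¹).left.base ((B.translation x).left.base z) = z := fun z => by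
    change ((B.translation x).left ≫ (B.translation x⁻¹).left) z = z
    rw [← Over.comp_left, AbelianVariety.translation_comp_translation_inv]
    rfl
  rw [Set.image_image]
  simp only [h, Set.image_id']

end AbelianVariety

/-! ## §2 Riemann theta divisors of complex Jacobians -/

namespace Jacobian

variable {X : SchemeOver ℂ} {𝒥 : Jacobian X}

/-- **`𝒪_J(−Θ) = 𝓘_{supp Θ}` for a Riemann theta divisor defining a principal polarisation** (smooth projective complex curve, `dim J ≥ 1`):
`Θ = 1 · t_x(W̃_{g−1}(P))` as a divisor — the support is irreducible (★ `IsRiemannThetaDivisor.isIrreducible_support`) and the multiplicity is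
one (§1). [cite: Lange2023AbelianVarietiesComplex, §4.2.1 Lemma 4.2.1 (ii) and Cor. 4.2.4] [cite: Milne1986JacobianVarieties, §6 (Θ = W^{g-1}, before Thm. 6.6)] -/
theorem IsRiemannThetaDivisor.idealSheaf_eq_primeDivisorIdeal (hX : IsSmoothProjective 1 X) (hdim : 1 ≤ 𝒥.J.dim)
    {Θ : CartierDivisor 𝒥.J.X.left} (h1 : 𝒥.IsRiemannThetaDivisor Θ) (h2 : 𝒥.J.IsPrincipalPolarizationDivisor Θ) :
    h1.isEffective.idealSheaf = primeDivisorIdeal (h1.isIrreducible_support hX).genericPoint :=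
  h2.idealSheaf_eq_primeDivisorIdeal hdim h1.isEffective
    ((h1.isIrreducible_support hX).closure_genericPoint h1.isClosed_support).symm

/-- **`Z(Θ)` is integral** for a Riemann theta divisor of a principal polarisation (smooth projective complex curve, `dim J ≥ 1`).
[cite: Lange2023AbelianVarietiesComplex, §4.2.1 Lemma 4.2.1 (ii) and Cor. 4.2.4] -/
theorem IsRiemannThetaDivisor.isIntegral_subscheme (hX : IsSmoothProjective 1 X) (hdim : 1 ≤ 𝒥.J.dim)
    {Θ : CartierDivisor 𝒥.J.X.left} (h1 : 𝒥.IsRiemannThetaDivisor Θ) (h2 : 𝒥.J.IsPrincipalPolarizationDivisor Θ) :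
    IsIntegral h1.isEffective.idealSheaf.subscheme :=
  h2.isIntegral_subscheme_idealSheaf hdim h1.isEffective (h1.isIrreducible_support hX)

/-- **`Z(Θ)` is reduced** for a Riemann theta divisor of a principal polarisation. [cite: Lange2023AbelianVarietiesComplex, §4.2.1 Lemma 4.2.1 (ii) and Cor. 4.2.4] -/
theorem IsRiemannThetaDivisor.isReduced_subscheme (hX : IsSmoothProjective 1 X) (hdim : 1 ≤ 𝒥.J.dim)
    {Θ : CartierDivisor 𝒥.J.X.left} (h1 : 𝒥.IsRiemannThetaDivisor Θ) (h2 : 𝒥.J.IsPrincipalPolarizationDivisor Θ) :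
    IsReduced h1.isEffective.idealSheaf.subscheme :=
  h2.isReduced_subscheme_idealSheaf hdim h1.isEffective (h1.isIrreducible_support hX)

/-- The underlying set of `Z(Θ)` is the support `J ∖ J_1` (a translate `t_x(W̃_{g−1}(P))`). [cite: Lange2023AbelianVarietiesComplex, §4.2.1 Cor. 4.2.4] -/
theorem IsRiemannThetaDivisor.range_subschemeι {k : Type u} [Field k] {C : SchemeOver k} {𝒥 : Jacobian C}
    {Θ : CartierDivisor 𝒥.J.X.left} (h1 : 𝒥.IsRiemannThetaDivisor Θ) :
    Set.range h1.isEffective.idealSheaf.subschemeι = (Θ.nonvanishing 1)ᶜ :=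
  h1.isEffective.range_subschemeι_idealSheaf

/-- **`𝒪_J(−Θ) = 𝓘_{W̃_{g−1}(P)}` when the support is exactly `W̃_{g−1}(P)`**: for a Riemann theta divisor `Θ` of a principal polarisation
with `J ∖ J_1 = W̃_{g−1}(P)` (no translation), the ideal sheaf of `Θ` is Mathlib's `vanishingIdeal` of the closed set `W̃_{g−1}(P)` — so the
closed subscheme `Z(Θ)` is BY NAME the reduced induced (integral, ★ `Jacobian.exists_isClosedImmersion_range_eq_brillNoetherLocus`)
structure on `W̃_{g−1}(P)`. [cite: Lange2023AbelianVarietiesComplex, §4.2.1 Lemma 4.2.1 (ii) and Cor. 4.2.4] [cite: Hartshorne1977, II Example 3.2.6] -/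
theorem IsRiemannThetaDivisor.idealSheaf_eq_vanishingIdeal_brillNoetherLocus (hX : IsSmoothProjective 1 X) (hdim : 1 ≤ 𝒥.J.dim)
    {Θ : CartierDivisor 𝒥.J.X.left} (h1 : 𝒥.IsRiemannThetaDivisor Θ) (h2 : 𝒥.J.IsPrincipalPolarizationDivisor Θ) (P : AlgPoints X ℂ)
    (hsupp : (Θ.nonvanishing 1)ᶜ = 𝒥.brillNoetherLocus P (𝒥.J.dim - 1)) :
    h1.isEffective.idealSheaf =
      Scheme.IdealSheafData.vanishingIdeal ⟨𝒥.brillNoetherLocus P (𝒥.J.dim - 1), 𝒥.isClosed_brillNoetherLocus P _⟩ := by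
  rw [h1.idealSheaf_eq_primeDivisorIdeal hX hdim h2, primeDivisorIdeal]
  congr 1
  exact TopologicalSpace.Closeds.ext
    (((h1.isIrreducible_support hX).closure_genericPoint h1.isClosed_support).trans hsupp)

/-- **Normalising the translate**: a Riemann theta divisor `Θ` with support `t_x(W̃_{g−1}(P))` has the translate `t_x^*Θ` with support
EXACTLY `W̃_{g−1}(P)`; the translate is again a Riemann theta divisor (★ `IsRiemannThetaDivisor.pullback_translation`) and, if `Θ` defines a
principal polarisation, so does `t_x^*Θ` (★ `IsPrincipalPolarizationDivisor.pullback_translation`).  Lange Cor. 4.2.4: `W̃_{g−1} = t_x^*Θ`.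
[cite: Lange2023AbelianVarietiesComplex, §4.2.1 Cor. 4.2.4] [cite: Milne1986JacobianVarieties, §6 (Θ = W^{g-1}, before Thm. 6.6)] -/
theorem IsRiemannThetaDivisor.exists_translate_support_eq_brillNoetherLocus {k : Type u} [Field k] {C : SchemeOver k}
    {𝒥 : Jacobian C} {Θ : CartierDivisor 𝒥.J.X.left} (h1 : 𝒥.IsRiemannThetaDivisor Θ) :
    ∃ (P : AlgPoints C k) (y : 𝒥.J.Points k), 𝒥.IsRiemannThetaDivisor (Θ.pullback (𝒥.J.translation y).left) ∧
      ((Θ.pullback (𝒥.J.translation y).left).nonvanishing 1)ᶜ = 𝒥.brillNoetherLocus P (𝒥.J.dim - 1) ∧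
      (𝒥.J.IsPrincipalPolarizationDivisor Θ → 𝒥.J.IsPrincipalPolarizationDivisor (Θ.pullback (𝒥.J.translation y).left)) := by
  obtain ⟨P, x, hsupp⟩ := h1.exists_support_eq
  refine ⟨P, x, h1.pullback_translation x, ?_, fun h2 => h2.pullback_translation x⟩
  rw [h1.isEffective.compl_nonvanishing_one_pullback, hsupp, AbelianVariety.preimage_translation_eq_image_translation_inv,
    AbelianVariety.image_translation_inv_image_translation]

/-- **`W̃_{g−1}(P)` with its reduced structure, as a theta divisor**: for a Riemann theta divisor `Θ` of a PRINCIPAL polarisation of the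
Jacobian of a smooth projective complex curve (`dim J ≥ 1`) there are a base point `P` and a translate `Θ″ = t_y^*Θ`, again Riemann and
principal, whose closed subscheme `Z(Θ″) ↪ J` (Mathlib `IdealSheafData.subschemeι`, a closed immersion) is INTEGRAL with underlying set exactly
`W̃_{g−1}(P)` and ideal sheaf `𝒪_J(−Θ″) = 𝓘_{W̃_{g−1}(P)}` (Mathlib `vanishingIdeal`) — the three hypotheses «closed immersion, integral, range `= W̃_{g−1}(P)`» of Step I of Lange's Lemma 4.4.4 on the étaleness road.
[cite: Lange2023AbelianVarietiesComplex, §4.2.1 Lemma 4.2.1 (ii) and Cor. 4.2.4] [cite: Milne1986JacobianVarieties, §6 (Θ = W^{g-1}, before Thm. 6.6)] -/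
theorem IsRiemannThetaDivisor.exists_translate_isIntegral_subscheme_range_eq_brillNoetherLocus (hX : IsSmoothProjective 1 X)
    (hdim : 1 ≤ 𝒥.J.dim) {Θ : CartierDivisor 𝒥.J.X.left} (h1 : 𝒥.IsRiemannThetaDivisor Θ) (h2 : 𝒥.J.IsPrincipalPolarizationDivisor Θ) :
    ∃ (P : AlgPoints X ℂ) (y : 𝒥.J.Points ℂ) (h1'' : 𝒥.IsRiemannThetaDivisor (Θ.pullback (𝒥.J.translation y).left)),
      𝒥.J.IsPrincipalPolarizationDivisor (Θ.pullback (𝒥.J.translation y).left) ∧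
      IsIntegral h1''.isEffective.idealSheaf.subscheme ∧
      Set.range h1''.isEffective.idealSheaf.subschemeι = 𝒥.brillNoetherLocus P (𝒥.J.dim - 1) ∧
      h1''.isEffective.idealSheaf =
        Scheme.IdealSheafData.vanishingIdeal ⟨𝒥.brillNoetherLocus P (𝒥.J.dim - 1), 𝒥.isClosed_brillNoetherLocus P _⟩ := by
  obtain ⟨P, y, h1'', hsupp, hpp⟩ := h1.exists_translate_support_eq_brillNoetherLocus
  have h2'' := hpp h2
  exact ⟨P, y, h1'', h2'', h1''.isIntegral_subscheme hX hdim h2'', by rw [h1''.range_subschemeι, hsupp],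
    h1''.idealSheaf_eq_vanishingIdeal_brillNoetherLocus hX hdim h2'' P hsupp⟩

/-! ## §3 (ed. 2) The binder shape of the Step-I producers: `Θ₀ ≥ 0` with support exactly `W̃_{g−1}(P)` -/

/-- **An effective divisor with support exactly `W̃_{g−1}(P)` is a Riemann theta divisor** (translation parameter `x = 1`, ★
`AbelianVariety.translation_one`) — the binder shape `(h0 : Θ₀.IsEffective) (hsupp : (Θ₀.nonvanishing 1)ᶜ = W̃_{dim J−1}(P))` of the
Step-I producers (Milne JV Lemma 6.7, letter (M″)). [cite: Milne1986JacobianVarieties, §6 (Θ = W^{g-1}, before Thm. 6.6)]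
[cite: Lange2023AbelianVarietiesComplex, §4.2.1 Cor. 4.2.4] -/
theorem isRiemannThetaDivisor_of_support_eq_brillNoetherLocus {k : Type u} [Field k] {C : SchemeOver k} {𝒥 : Jacobian C}
    {Θ₀ : CartierDivisor 𝒥.J.X.left} (h0 : Θ₀.IsEffective) (P : AlgPoints C k)
    (hsupp : (Θ₀.nonvanishing 1)ᶜ = 𝒥.brillNoetherLocus P (𝒥.J.dim - 1)) : 𝒥.IsRiemannThetaDivisor Θ₀ := by
  refine ⟨h0, P, 1, ?_⟩
  rw [hsupp, AbelianVariety.translation_one]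
  exact (Set.image_id _).symm

/-- The underlying set of `Z(Θ₀)` is `W̃_{g−1}(P)` when the support of the effective divisor `Θ₀` is. [cite: Lange2023AbelianVarietiesComplex, §4.2.1 Cor. 4.2.4] -/
theorem range_subschemeι_of_support_eq_brillNoetherLocus {k : Type u} [Field k] {C : SchemeOver k} {𝒥 : Jacobian C}
    {Θ₀ : CartierDivisor 𝒥.J.X.left} (h0 : Θ₀.IsEffective) (P : AlgPoints C k)
    (hsupp : (Θ₀.nonvanishing 1)ᶜ = 𝒥.brillNoetherLocus P (𝒥.J.dim - 1)) :
    Set.range h0.idealSheaf.subschemeι = 𝒥.brillNoetherLocus P (𝒥.J.dim - 1) := by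
  rw [h0.range_subschemeι_idealSheaf, hsupp]

/-- **`𝒪_J(−Θ₀) = 𝓘_{W̃_{g−1}(P)}` in the producers' binder shape**: an effective PRINCIPAL polarisation divisor `Θ₀` of the Jacobian of a
smooth projective complex curve (`dim J ≥ 1`) with support exactly `W̃_{g−1}(P)` has ideal sheaf the `vanishingIdeal` of `W̃_{g−1}(P)`.
[cite: Lange2023AbelianVarietiesComplex, §4.2.1 Lemma 4.2.1 (ii) and Cor. 4.2.4] [cite: Hartshorne1977, II.6 Prop. 6.11 and Remark 6.11.2 (pp. 141–142)] -/
theorem idealSheaf_eq_vanishingIdeal_brillNoetherLocus_of_support_eq (hX : IsSmoothProjective 1 X) (hdim : 1 ≤ 𝒥.J.dim)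
    (P : AlgPoints X ℂ) {Θ₀ : CartierDivisor 𝒥.J.X.left} (h0 : Θ₀.IsEffective)
    (hsupp : (Θ₀.nonvanishing 1)ᶜ = 𝒥.brillNoetherLocus P (𝒥.J.dim - 1)) (hpr : 𝒥.J.IsPrincipalPolarizationDivisor Θ₀) :
    h0.idealSheaf = Scheme.IdealSheafData.vanishingIdeal ⟨𝒥.brillNoetherLocus P (𝒥.J.dim - 1), 𝒥.isClosed_brillNoetherLocus P _⟩ :=
  (isRiemannThetaDivisor_of_support_eq_brillNoetherLocus h0 P hsupp).idealSheaf_eq_vanishingIdeal_brillNoetherLocus hX hdim hpr P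
    hsupp

/-- **`Z(Θ₀)` is integral in the producers' binder shape** (effective principal polarisation divisor with support exactly `W̃_{g−1}(P)`,
smooth projective complex curve, `dim J ≥ 1`) — the source factor of the incidence `ψ : C × Z(Θ₀) → J` of road (E).
[cite: Lange2023AbelianVarietiesComplex, §4.2.1 Lemma 4.2.1 (ii) and Cor. 4.2.4] [cite: Milne1986JacobianVarieties, §6 (Θ = W^{g-1}, before Thm. 6.6)] -/
theorem isIntegral_subscheme_of_support_eq_brillNoetherLocus (hX : IsSmoothProjective 1 X) (hdim : 1 ≤ 𝒥.J.dim)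
    (P : AlgPoints X ℂ) {Θ₀ : CartierDivisor 𝒥.J.X.left} (h0 : Θ₀.IsEffective)
    (hsupp : (Θ₀.nonvanishing 1)ᶜ = 𝒥.brillNoetherLocus P (𝒥.J.dim - 1)) (hpr : 𝒥.J.IsPrincipalPolarizationDivisor Θ₀) :
    IsIntegral h0.idealSheaf.subscheme :=
  (isRiemannThetaDivisor_of_support_eq_brillNoetherLocus h0 P hsupp).isIntegral_subscheme hX hdim hpr

/-- `Z(Θ₀)` is reduced in the producers' binder shape. [cite: Lange2023AbelianVarietiesComplex, §4.2.1 Lemma 4.2.1 (ii) and Cor. 4.2.4] -/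
theorem isReduced_subscheme_of_support_eq_brillNoetherLocus (hX : IsSmoothProjective 1 X) (hdim : 1 ≤ 𝒥.J.dim)
    (P : AlgPoints X ℂ) {Θ₀ : CartierDivisor 𝒥.J.X.left} (h0 : Θ₀.IsEffective)
    (hsupp : (Θ₀.nonvanishing 1)ᶜ = 𝒥.brillNoetherLocus P (𝒥.J.dim - 1)) (hpr : 𝒥.J.IsPrincipalPolarizationDivisor Θ₀) :
    IsReduced h0.idealSheaf.subscheme :=
  (isRiemannThetaDivisor_of_support_eq_brillNoetherLocus h0 P hsupp).isReduced_subscheme hX hdim hpr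

end Jacobian

end Literature.AlgebraicGeometry.Motives

end
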